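import Mathlib
import HarnessLib
import Summits.NavierStokesRegularity.NavierStokesRegularity.Theorems.PoloidalWindowDoorLrcModEntireRidgeClassConstants
import Summits.NavierStokesRegularity.NavierStokesRegularity.Theorems.PoloidalWindowDoorLrcModEntireThreadPressure

/-!
# Item `LrcModEntire` (stmt-NavierStokesRegularity-20428) — (Q4) cell, mechanism M1 (web transport): THE DYNAMIC SHEET-SPEED LAW — the web's normal speed against the
# vertical Navier–Stokes equation at a web point

ns-k2-port-2 g6 (helper prover under the LEAD of item 20428, ns-poloidal-K2-p3 g15; `--supports stmt-NavierStokesRegularity-20428 --as helper`).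
The kinematic sheet-speed law `…RidgeWebCurves.spacetimeHessian_sheetVelocity_normal_eq_zero` (p716063) says `D²(uncurry F)(τ,y₀)[(1, Vν), (0, ν)] = 0` at a web point
(`F a = σU₂(−1+a,·)`, `V = ∂_τ n₀` the normal speed of the web curve, `ν` the horizontal normal).  This file reads it against the fluid: with `t = −1+τ`,
`A(y) := ∂ₜU₂(t,y)` and the vertical convective term `Cv(y) := ((U·∇)U)₂(t,y)`,

* `fderiv_partial_apply'` — `D(v ↦ DG(v)[w])(u)[h] = D²G(u)[h][w]` (any normed domain);
* `sheetSpeed_eq_fderiv_timeDeriv` — **`V·D²(F τ)(y₀)[ν,ν] = −σ·∂_νA(y₀)`** (bilinearity + symmetry of the space–time Hessian of the jointly `C²` signed component; the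
  time derivative `timeDerivWithin (Iio 0) U t` is the `(1,0)`-partial of `uncurry U`);
* `fderiv_convect_two_of_horizCritical` — at a point where `∇ₕU₂ = 0`, for a HORIZONTAL direction `ν` (`ν₂ = 0`): **`∂_νCv(y₀) = D²U₂(y₀)[ν, U(y₀)]`** (the term
  `DU₂[∂_νU]` drops because `(∂_νU)₂ = ∂_νU₂ = 0`);
* `sheetSpeed_dynamic` — with the vertical momentum balance `A + Cv = Φ` on the slice (`Φ = (ΔU − ∇P)₂` for any classical pressure,
  `IsClassicalNSSolutionOn.momentum`): **`V·D²(F τ)(y₀)[ν,ν] + σ·∂_νΦ(y₀) = σ·D²U₂(y₀)[ν, U(y₀)]`** — i.e. with `κ_ν = −D²(σU₂)[ν,ν] > 0` on the tube: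
  `κ_ν·V = σ(∂_νΦ − D²U₂[ν,U])`, the first law of the programme that contains the horizontal velocity ON the ridge (memo T2B-g14 §10/§12/§14b M1).

WHAT THIS IS NOT: not a claim about Navier–Stokes regularity — an identity on the hypothetical homogeneous null ridge of the research cell (Q4) (bears_on LADDER-NS N0, item 20428 /
crux 19708; 20428/19708/27893 OPEN; (Q4) OPEN).  No summit statement is proved here.
-/

noncomputable section

-- the summit and its single sub-problem share the name (CONVENTIONS §1), as in every Theorems file
set_option linter.dupNamespace false

namespace Summit.NavierStokesRegularity.NavierStokesRegularity.Theorems.PoloidalWindowDoorLrcModEntireRidgeWebDynamics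

open Set Filter Topology Metric Function
open scoped ContDiff
open Literature.Analysis Literature.Analysis.FluidPDE
open Summit.NavierStokesRegularity.NavierStokesRegularity.Theorems.PoloidalWindowDoorLrcModEntireRidgeClassConstants
open Summit.NavierStokesRegularity.NavierStokesRegularity.Theorems.PoloidalWindowDoorLrcModEntireThreadPressure
open Summit.NavierStokesRegularity.NavierStokesRegularity.Theorems.PoloidalWindowDoorPoloidalWindowRigidityWindow

/-- `D(v ↦ DG(v)[w])(u)[h] = D²G(u)[h][w]` when `DG` is differentiable at `u` (any normed domain). [folklore] -/
theorem fderiv_partial_apply' {E : Type*} [NormedAddCommGroup E] [NormedSpace ℝ E] {G : E → ℝ} {u : E} (hG : DifferentiableAt ℝ (fderiv ℝ G) u) (w h : E) :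
    fderiv ℝ (fun v => fderiv ℝ G v w) u h = fderiv ℝ (fderiv ℝ G) u h w := by
  set A : (E →L[ℝ] ℝ) →L[ℝ] ℝ := ContinuousLinearMap.apply ℝ ℝ w with hA
  have e : (fun v => fderiv ℝ G v w) = A ∘ fderiv ℝ G := by funext v; simp [hA]
  rw [e, (A.hasFDerivAt.comp u hG.hasFDerivAt).fderiv]
  simp [hA]

variable {C : ℝ} {U : ℝ → EuclideanSpace ℝ (Fin 3) → EuclideanSpace ℝ (Fin 3)}

/-- **THE SHEET SPEED AGAINST THE TIME DERIVATIVE.**  Class `U`, `σ = ±1`, `|τ| < 1/2`, `F a = σU₂(−1+a,·)`; if the space–time Hessian annihilates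
`((1, Vν), (0, ν))` at `(τ, y₀)` (the kinematic sheet-speed law) then `V·D²(F τ)(y₀)[ν,ν] = −σ·∂_ν(∂ₜU₂(−1+τ,·))(y₀)`. -/
theorem sheetSpeed_eq_fderiv_timeDeriv (hrate : HasTypeITimeDecay C U) (hcont : ContinuousOn (uncurry U) (Iio (0 : ℝ) ×ˢ univ))
    (hmild : ∀ s t : ℝ, s < t → t < 0 → ∀ x, U t x = UnboundedOperators.heatExtension (U s) (t - s) x - oseenDuhamel 1 s U U t x)
    (hdiv : ∀ t < 0, VectorCalculus.IsDivFree (U t)) {σ : ℝ} (hσ : σ = 1 ∨ σ = -1) {τ : ℝ} (hτ : |τ| < 1 / 2)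
    {y₀ ν : EuclideanSpace ℝ (Fin 3)} {V : ℝ}
    (hsheet : fderiv ℝ (fderiv ℝ (uncurry fun a y => σ * U (-1 + a) y 2)) (τ, y₀) ((1 : ℝ), V • ν) ((0 : ℝ), ν) = 0) :
    V * fderiv ℝ (fderiv ℝ (fun y => σ * U (-1 + τ) y 2)) y₀ ν ν =
      -(σ * fderiv ℝ (fun y => (timeDerivWithin (Iio 0) U (-1 + τ) y) 2) y₀ ν) := by
  have hσσ : σ * σ = 1 := by rcases hσ with h | h <;> simp [h]
  set G : ℝ × EuclideanSpace ℝ (Fin 3) → ℝ := uncurry fun a y => σ * U (-1 + a) y 2 with hG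
  set t : ℝ := -1 + τ with ht
  have htneg : t < 0 := by rw [ht]; linarith [(abs_lt.1 hτ).2]
  -- `G` is `C²` near `(τ, y)` for every `y`
  have hT : Ioo (-1 / 2 : ℝ) (1 / 2) ×ˢ (univ : Set (EuclideanSpace ℝ (Fin 3))) ∈ 𝓝 ((τ, y₀) : ℝ × EuclideanSpace ℝ (Fin 3)) :=
    (isOpen_Ioo.prod isOpen_univ).mem_nhds ⟨⟨by linarith [(abs_lt.1 hτ).1], by linarith [(abs_lt.1 hτ).2]⟩, mem_univ _⟩
  have hG2on : ContDiffOn ℝ 2 G (Ioo (-1 / 2 : ℝ) (1 / 2) ×ˢ (univ : Set (EuclideanSpace ℝ (Fin 3)))) :=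
    contDiffOn_uncurry_signed hrate hcont hmild hdiv σ (n := 2) Subset.rfl
  have hG2 : ∀ y : EuclideanSpace ℝ (Fin 3), ContDiffAt ℝ 2 G (τ, y) := fun y =>
    hG2on.contDiffAt ((isOpen_Ioo.prod isOpen_univ).mem_nhds ⟨⟨by linarith [(abs_lt.1 hτ).1], by linarith [(abs_lt.1 hτ).2]⟩, mem_univ _⟩)
  have hGd : ∀ y : EuclideanSpace ℝ (Fin 3), DifferentiableAt ℝ G (τ, y) := fun y => (hG2 y).differentiableAt (by norm_num)
  have hDGd : DifferentiableAt ℝ (fderiv ℝ G) (τ, y₀) := ((hG2 y₀).fderiv_right (m := 1) le_rfl).differentiableAt (by simp)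
  -- bilinearity and symmetry of the space–time Hessian
  have hsymm : fderiv ℝ (fderiv ℝ G) (τ, y₀) ((1 : ℝ), (0 : EuclideanSpace ℝ (Fin 3))) ((0 : ℝ), ν) =
      fderiv ℝ (fderiv ℝ G) (τ, y₀) ((0 : ℝ), ν) ((1 : ℝ), (0 : EuclideanSpace ℝ (Fin 3))) :=
    (hG2 y₀).isSymmSndFDerivAt (by simp only [minSmoothness_of_isRCLikeNormedField]; norm_num) _ _
  have hsplit : fderiv ℝ (fderiv ℝ G) (τ, y₀) ((1 : ℝ), V • ν) ((0 : ℝ), ν) =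
      fderiv ℝ (fderiv ℝ G) (τ, y₀) ((1 : ℝ), (0 : EuclideanSpace ℝ (Fin 3))) ((0 : ℝ), ν) +
        V * fderiv ℝ (fderiv ℝ G) (τ, y₀) ((0 : ℝ), ν) ((0 : ℝ), ν) := by
    have e : (((1 : ℝ), V • ν) : ℝ × EuclideanSpace ℝ (Fin 3)) = ((1 : ℝ), (0 : EuclideanSpace ℝ (Fin 3))) + V • ((0 : ℝ), ν) := by
      ext <;> simp
    rw [e, map_add, map_smul]
    simp
  -- (i) the `(0,ν),(0,ν)` entry is the slice Hessian
  have hslice_grad : ∀ y : EuclideanSpace ℝ (Fin 3), fderiv ℝ G (τ, y) ((0 : ℝ), ν) = fderiv ℝ (fun y => σ * U (-1 + τ) y 2) y ν := by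
    intro y
    have hι : HasFDerivAt (fun w : EuclideanSpace ℝ (Fin 3) => ((τ, w) : ℝ × EuclideanSpace ℝ (Fin 3)))
        (ContinuousLinearMap.inr ℝ ℝ (EuclideanSpace ℝ (Fin 3))) y := hasFDerivAt_prodMk_right τ y
    have hc := (hGd y).hasFDerivAt.comp y hι
    have e : (G ∘ fun w : EuclideanSpace ℝ (Fin 3) => ((τ, w) : ℝ × EuclideanSpace ℝ (Fin 3))) = fun y => σ * U (-1 + τ) y 2 := by
      funext w; simp [hG]
    rw [e] at hc
    rw [hc.fderiv]; rfl
  have hνν : fderiv ℝ (fderiv ℝ G) (τ, y₀) ((0 : ℝ), ν) ((0 : ℝ), ν) = fderiv ℝ (fderiv ℝ (fun y => σ * U (-1 + τ) y 2)) y₀ ν ν := by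
    rw [← fderiv_partial_apply' hDGd]
    -- differentiate `y ↦ DG(τ,y)[(0,ν)] = D(F τ)(y)[ν]` along the slice
    have hι : HasFDerivAt (fun w : EuclideanSpace ℝ (Fin 3) => ((τ, w) : ℝ × EuclideanSpace ℝ (Fin 3)))
        (ContinuousLinearMap.inr ℝ ℝ (EuclideanSpace ℝ (Fin 3))) y₀ := hasFDerivAt_prodMk_right τ y₀
    have hφd : DifferentiableAt ℝ (fun q => fderiv ℝ G q ((0 : ℝ), ν)) (τ, y₀) := by
      set A : (ℝ × EuclideanSpace ℝ (Fin 3) →L[ℝ] ℝ) →L[ℝ] ℝ := ContinuousLinearMap.apply ℝ ℝ ((0 : ℝ), ν) with hA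
      have e : (fun q => fderiv ℝ G q ((0 : ℝ), ν)) = A ∘ fderiv ℝ G := by funext q; simp [hA]
      rw [e]; exact A.differentiableAt.comp _ hDGd
    have hc := hφd.hasFDerivAt.comp y₀ hι
    have e : ((fun q => fderiv ℝ G q ((0 : ℝ), ν)) ∘ fun w : EuclideanSpace ℝ (Fin 3) => ((τ, w) : ℝ × EuclideanSpace ℝ (Fin 3))) =
        fun y => fderiv ℝ (fun y => σ * U (-1 + τ) y 2) y ν := by
      funext w; simp only [Function.comp_apply]; exact hslice_grad w
    rw [e] at hc
    have happ := congrArg (fun L : EuclideanSpace ℝ (Fin 3) →L[ℝ] ℝ => L ν) hc.fderiv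
    simp only [ContinuousLinearMap.comp_apply, ContinuousLinearMap.inr_apply] at happ
    rw [fderiv_partial_apply' (G := fun y => σ * U (-1 + τ) y 2)] at happ
    · exact happ.symm
    · -- `D(F τ)` differentiable at `y₀`
      have hF2 : ContDiff ℝ 2 (fun y => σ * U (-1 + τ) y 2) := contDiff_signed_slice hrate hcont hmild hdiv htneg σ
      exact ((hF2.fderiv_right (m := 1) le_rfl).differentiable (by simp)) y₀
  -- (ii) the `(0,ν),(1,0)` entry is the `ν`-derivative of `σ·∂ₜU₂`
  have htime : ∀ y : EuclideanSpace ℝ (Fin 3), fderiv ℝ G (τ, y) ((1 : ℝ), (0 : EuclideanSpace ℝ (Fin 3))) =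
      σ * (timeDerivWithin (Iio 0) U t y) 2 := by
    intro y
    have hι : HasDerivAt (fun a : ℝ => ((a, y) : ℝ × EuclideanSpace ℝ (Fin 3))) ((1 : ℝ), (0 : EuclideanSpace ℝ (Fin 3))) τ :=
      (hasDerivAt_id τ).prodMk (hasDerivAt_const τ y)
    have hc := (hGd y).hasFDerivAt.comp_hasDerivAt τ hι
    have e : (G ∘ fun a : ℝ => ((a, y) : ℝ × EuclideanSpace ℝ (Fin 3))) = fun a => σ * U (-1 + a) y 2 := by funext a; simp [hG]
    rw [e] at hc
    -- shift to `s = −1 + a`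
    have eτ : t + 1 = τ := by rw [ht]; ring
    have hc' : HasDerivAt (fun a => σ * U (-1 + a) y 2) (fderiv ℝ G (τ, y) ((1 : ℝ), (0 : EuclideanSpace ℝ (Fin 3)))) (t + 1) := by
      rw [eτ]; exact hc
    have hsh := (HasDerivAt.comp_add_const t 1 hc').const_mul σ
    have e3 : (fun s : ℝ => σ * (σ * U (-1 + (s + 1)) y 2)) = fun s => U s y 2 := by
      funext s; rw [← mul_assoc, hσσ, one_mul, show -1 + (s + 1) = s by ring]
    rw [e3] at hsh
    -- the time derivative within `Iio 0` is the plain derivative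
    have hsm : IsSmoothSpaceTimeOn (Iio 0) U := (isTypeIAncientMild_of_class hrate hcont hmild hdiv).contDiffOn
    have htd : timeDerivWithin (Iio 0) U t y = deriv (fun s => U s y) t := by
      rw [timeDerivWithin_apply, derivWithin_of_mem_nhds (Iio_mem_nhds htneg)]
    have hline : DifferentiableAt ℝ (fun s => U s y) t := by
      have hct : ContDiffAt ℝ ∞ (uncurry U) (t, y) := hsm.contDiffAt isOpen_Iio (mem_Iio.2 htneg) y
      have hd : DifferentiableAt ℝ (uncurry U) (t, y) := hct.differentiableAt (by simp)
      have hl : DifferentiableAt ℝ (fun s : ℝ => ((s, y) : ℝ × EuclideanSpace ℝ (Fin 3))) t :=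
        differentiableAt_id.prodMk (differentiableAt_const _)
      have h := hd.comp t hl
      exact h
    rw [htd, deriv_apply_coord hline 2, hsh.deriv, ← mul_assoc, hσσ, one_mul]
  have hν1 : fderiv ℝ (fderiv ℝ G) (τ, y₀) ((0 : ℝ), ν) ((1 : ℝ), (0 : EuclideanSpace ℝ (Fin 3))) =
      σ * fderiv ℝ (fun y => (timeDerivWithin (Iio 0) U t y) 2) y₀ ν := by
    rw [← fderiv_partial_apply' hDGd]
    have hι : HasFDerivAt (fun w : EuclideanSpace ℝ (Fin 3) => ((τ, w) : ℝ × EuclideanSpace ℝ (Fin 3)))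
        (ContinuousLinearMap.inr ℝ ℝ (EuclideanSpace ℝ (Fin 3))) y₀ := hasFDerivAt_prodMk_right τ y₀
    have hφd : DifferentiableAt ℝ (fun q => fderiv ℝ G q ((1 : ℝ), (0 : EuclideanSpace ℝ (Fin 3)))) (τ, y₀) := by
      set A : (ℝ × EuclideanSpace ℝ (Fin 3) →L[ℝ] ℝ) →L[ℝ] ℝ := ContinuousLinearMap.apply ℝ ℝ ((1 : ℝ), (0 : EuclideanSpace ℝ (Fin 3))) with hA
      have e : (fun q => fderiv ℝ G q ((1 : ℝ), (0 : EuclideanSpace ℝ (Fin 3)))) = A ∘ fderiv ℝ G := by funext q; simp [hA]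
      rw [e]; exact A.differentiableAt.comp _ hDGd
    have hc := hφd.hasFDerivAt.comp y₀ hι
    have e : ((fun q => fderiv ℝ G q ((1 : ℝ), (0 : EuclideanSpace ℝ (Fin 3)))) ∘ fun w : EuclideanSpace ℝ (Fin 3) => ((τ, w) : ℝ × EuclideanSpace ℝ (Fin 3))) =
        fun y => σ * (timeDerivWithin (Iio 0) U t y) 2 := by
      funext w; simp only [Function.comp_apply]; exact htime w
    rw [e] at hc
    have happ := congrArg (fun L : EuclideanSpace ℝ (Fin 3) →L[ℝ] ℝ => L ν) hc.fderiv
    simp only [ContinuousLinearMap.comp_apply, ContinuousLinearMap.inr_apply] at happ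
    -- `D(σ·A)(y₀)[ν] = σ·DA(y₀)[ν]`
    have hAd : DifferentiableAt ℝ (fun y => (timeDerivWithin (Iio 0) U t y) 2) y₀ := by
      have hσ0 : σ ≠ 0 := by rcases hσ with h | h <;> simp [h]
      have hd : DifferentiableAt ℝ (fun y => σ * (timeDerivWithin (Iio 0) U t y) 2) y₀ := hc.differentiableAt
      have := hd.const_mul σ⁻¹
      simp only [← mul_assoc, inv_mul_cancel₀ hσ0, one_mul] at this
      exact this
    rw [← happ, fderiv_const_mul hAd]
    simp
  -- assemble
  rw [hsplit, hsymm, hν1, hνν] at hsheet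
  linarith

/-- **The `ν`-derivative of the vertical convective term at a horizontally critical point**: `U t ∈ C²`, `∂₀U₂ = ∂₁U₂ = 0` at `y₀`, `ν` horizontal (`ν₂ = 0`) ⇒
`∂_ν((U·∇)U)₂(y₀) = D²U₂(y₀)[ν, U(y₀)]`. -/
theorem fderiv_convect_two_of_horizCritical {W : EuclideanSpace ℝ (Fin 3) → EuclideanSpace ℝ (Fin 3)} (hW : ContDiff ℝ 2 W) {y₀ ν : EuclideanSpace ℝ (Fin 3)}
    (hν : ν 2 = 0) (h0 : fderiv ℝ W y₀ (EuclideanSpace.single 0 1) 2 = 0) (h1 : fderiv ℝ W y₀ (EuclideanSpace.single 1 1) 2 = 0) :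
    fderiv ℝ (fun y => (convect W W y) 2) y₀ ν = fderiv ℝ (fderiv ℝ (fun y => W y 2)) y₀ ν (W y₀) := by
  set θ : EuclideanSpace ℝ (Fin 3) → ℝ := fun y => W y 2 with hθ
  have hθ2 : ContDiff ℝ 2 θ := (contDiff_piLp_apply (p := 2) (𝕜 := ℝ) (E := fun _ : Fin 3 => ℝ) (i := (2 : Fin 3))).comp hW
  have hWd : Differentiable ℝ W := hW.differentiable (by norm_num)
  have hθd : Differentiable ℝ θ := hθ2.differentiable (by norm_num)
  have hDθd : Differentiable ℝ (fderiv ℝ θ) := (hθ2.fderiv_right (m := 1) le_rfl).differentiable (by simp)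
  -- the vertical component of `DW(y)[w]` is `Dθ(y)[w]`
  have hcomp : ∀ y w, fderiv ℝ W y w 2 = fderiv ℝ θ y w := fun y w => by
    have h := ((EuclideanSpace.proj (𝕜 := ℝ) (2 : Fin 3)).hasFDerivAt.comp y (hWd y).hasFDerivAt).fderiv
    have e : (⇑(EuclideanSpace.proj (𝕜 := ℝ) (2 : Fin 3)) ∘ W) = θ := by funext y; simp [hθ]
    rw [e] at h
    rw [h]; rfl
  have hconv : (fun y => (convect W W y) 2) = fun y => fderiv ℝ θ y (W y) := by
    funext y; rw [convect_apply, hcomp]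
  -- `Dθ(y₀)` vanishes on horizontal vectors, hence on `ν` and on `∂_νW` (whose vertical component is `∂_νθ = 0`)
  have hθν : fderiv ℝ θ y₀ ν = 0 := by
    have e : ν = ν 0 • EuclideanSpace.single 0 (1 : ℝ) + ν 1 • EuclideanSpace.single 1 (1 : ℝ) + ν 2 • EuclideanSpace.single 2 (1 : ℝ) := by
      ext i; fin_cases i <;> simp
    have h0' : fderiv ℝ θ y₀ (EuclideanSpace.single 0 1) = 0 := by rw [← hcomp]; exact h0
    have h1' : fderiv ℝ θ y₀ (EuclideanSpace.single 1 1) = 0 := by rw [← hcomp]; exact h1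
    rw [e, map_add, map_add, map_smul, map_smul, map_smul, h0', h1', hν]
    simp
  have hθw : fderiv ℝ θ y₀ (fderiv ℝ W y₀ ν) = 0 := by
    set w := fderiv ℝ W y₀ ν with hw
    have e : w = w 0 • EuclideanSpace.single 0 (1 : ℝ) + w 1 • EuclideanSpace.single 1 (1 : ℝ) + w 2 • EuclideanSpace.single 2 (1 : ℝ) := by
      ext i; fin_cases i <;> simp
    have h0' : fderiv ℝ θ y₀ (EuclideanSpace.single 0 1) = 0 := by rw [← hcomp]; exact h0
    have h1' : fderiv ℝ θ y₀ (EuclideanSpace.single 1 1) = 0 := by rw [← hcomp]; exact h1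
    have hw2 : w 2 = 0 := by rw [hw, hcomp]; exact hθν
    rw [e, map_add, map_add, map_smul, map_smul, map_smul, h0', h1', hw2]
    simp
  -- product rule for `y ↦ Dθ(y)[W y]`
  have hprod : HasFDerivAt (fun y => fderiv ℝ θ y (W y))
      ((fderiv ℝ θ y₀).comp (fderiv ℝ W y₀) + (fderiv ℝ (fderiv ℝ θ) y₀).flip (W y₀)) y₀ :=
    (hDθd y₀).hasFDerivAt.clm_apply (hWd y₀).hasFDerivAt
  rw [hconv, hprod.fderiv]
  simp [hθw]

/-- **THE DYNAMIC SHEET-SPEED LAW.**  Class `U`, `σ = ±1`, `|τ| < 1/2`, `t = −1+τ`; a web point `y₀` (horizontally critical: `∂₀U₂ = ∂₁U₂ = 0`) with horizontal normal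
`ν` and the kinematic sheet-speed law with normal speed `V`; the vertical momentum balance `∂ₜU₂ + ((U·∇)U)₂ = Φ` on the slice `t` (`Φ = (ΔU − ∇P)₂`,
`IsClassicalNSSolutionOn.momentum`).  Then **`V·D²(σU₂(t,·))(y₀)[ν,ν] + σ·∂_νΦ(y₀) = σ·D²U₂(t,·)(y₀)[ν, U(t,y₀)]`**. -/
theorem sheetSpeed_dynamic (hrate : HasTypeITimeDecay C U) (hcont : ContinuousOn (uncurry U) (Iio (0 : ℝ) ×ˢ univ))
    (hmild : ∀ s t : ℝ, s < t → t < 0 → ∀ x, U t x = UnboundedOperators.heatExtension (U s) (t - s) x - oseenDuhamel 1 s U U t x)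
    (hdiv : ∀ t < 0, VectorCalculus.IsDivFree (U t)) {σ : ℝ} (hσ : σ = 1 ∨ σ = -1) {τ : ℝ} (hτ : |τ| < 1 / 2)
    {y₀ ν : EuclideanSpace ℝ (Fin 3)} (hν : ν 2 = 0)
    (h0 : fderiv ℝ (U (-1 + τ)) y₀ (EuclideanSpace.single 0 1) 2 = 0) (h1 : fderiv ℝ (U (-1 + τ)) y₀ (EuclideanSpace.single 1 1) 2 = 0)
    {V : ℝ} (hsheet : fderiv ℝ (fderiv ℝ (uncurry fun a y => σ * U (-1 + a) y 2)) (τ, y₀) ((1 : ℝ), V • ν) ((0 : ℝ), ν) = 0)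
    {Φ : EuclideanSpace ℝ (Fin 3) → ℝ}
    (hNS : ∀ y, (timeDerivWithin (Iio 0) U (-1 + τ) y) 2 + (convect (U (-1 + τ)) (U (-1 + τ)) y) 2 = Φ y) :
    V * fderiv ℝ (fderiv ℝ (fun y => σ * U (-1 + τ) y 2)) y₀ ν ν + σ * fderiv ℝ Φ y₀ ν =
      σ * fderiv ℝ (fderiv ℝ (fun y => U (-1 + τ) y 2)) y₀ ν (U (-1 + τ) y₀) := by
  set t : ℝ := -1 + τ with ht
  have htneg : t < 0 := by rw [ht]; linarith [(abs_lt.1 hτ).2]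
  have hslice : ContDiff ℝ 2 (U t) := contDiff_slice_of_class hrate hcont hmild hdiv htneg
  have h1law := sheetSpeed_eq_fderiv_timeDeriv hrate hcont hmild hdiv hσ hτ (y₀ := y₀) (ν := ν) (V := V) hsheet
  have h2law := fderiv_convect_two_of_horizCritical hslice hν h0 h1
  -- `Φ = A + Cv` as functions; differentiate at `y₀` along `ν`
  have hΦ : Φ = fun y => (timeDerivWithin (Iio 0) U t y) 2 + (convect (U t) (U t) y) 2 := by funext y; exact (hNS y).symm
  have hCvd : DifferentiableAt ℝ (fun y => (convect (U t) (U t) y) 2) y₀ := by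
    have hθ2 : ContDiff ℝ 2 (fun y => U t y 2) := (contDiff_piLp_apply (p := 2) (𝕜 := ℝ) (E := fun _ : Fin 3 => ℝ) (i := (2 : Fin 3))).comp hslice
    have hDθd : Differentiable ℝ (fderiv ℝ fun y => U t y 2) := (hθ2.fderiv_right (m := 1) le_rfl).differentiable (by simp)
    have hWd : Differentiable ℝ (U t) := hslice.differentiable (by norm_num)
    have hcomp : ∀ y w, fderiv ℝ (U t) y w 2 = fderiv ℝ (fun y => U t y 2) y w := fun y w => by
      have h := ((EuclideanSpace.proj (𝕜 := ℝ) (2 : Fin 3)).hasFDerivAt.comp y (hWd y).hasFDerivAt).fderiv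
      have e : (⇑(EuclideanSpace.proj (𝕜 := ℝ) (2 : Fin 3)) ∘ U t) = fun y => U t y 2 := by funext y; simp
      rw [e] at h
      rw [h]; rfl
    have e : (fun y => (convect (U t) (U t) y) 2) = fun y => fderiv ℝ (fun y => U t y 2) y (U t y) := by
      funext y; rw [convect_apply, hcomp]
    rw [e]
    exact ((hDθd y₀).hasFDerivAt.clm_apply (hWd y₀).hasFDerivAt).differentiableAt
  have hAd : DifferentiableAt ℝ (fun y => (timeDerivWithin (Iio 0) U t y) 2) y₀ := by
    -- `A = Φ − Cv` near `y₀`? We only know `Φ = A + Cv`; use instead the smoothness of `A` via the class (as in `sheetSpeed_eq_fderiv_timeDeriv`):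
    -- `σ·A` is the slice of `q ↦ DG(q)[(1,0)]`, differentiable; divide by `σ`.
    have hσσ : σ * σ = 1 := by rcases hσ with h | h <;> simp [h]
    have hσ0 : σ ≠ 0 := by rcases hσ with h | h <;> simp [h]
    set G : ℝ × EuclideanSpace ℝ (Fin 3) → ℝ := uncurry fun a y => σ * U (-1 + a) y 2 with hG
    have hG2on : ContDiffOn ℝ 2 G (Ioo (-1 / 2 : ℝ) (1 / 2) ×ˢ (univ : Set (EuclideanSpace ℝ (Fin 3)))) :=
      contDiffOn_uncurry_signed hrate hcont hmild hdiv σ (n := 2) Subset.rfl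
    have hG2 : ∀ y : EuclideanSpace ℝ (Fin 3), ContDiffAt ℝ 2 G (τ, y) := fun y =>
      hG2on.contDiffAt ((isOpen_Ioo.prod isOpen_univ).mem_nhds ⟨⟨by linarith [(abs_lt.1 hτ).1], by linarith [(abs_lt.1 hτ).2]⟩, mem_univ _⟩)
    have hGd : ∀ y : EuclideanSpace ℝ (Fin 3), DifferentiableAt ℝ G (τ, y) := fun y => (hG2 y).differentiableAt (by norm_num)
    have hDGd : DifferentiableAt ℝ (fderiv ℝ G) (τ, y₀) := ((hG2 y₀).fderiv_right (m := 1) le_rfl).differentiableAt (by simp)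
    have htime : ∀ y : EuclideanSpace ℝ (Fin 3), fderiv ℝ G (τ, y) ((1 : ℝ), (0 : EuclideanSpace ℝ (Fin 3))) = σ * (timeDerivWithin (Iio 0) U t y) 2 := by
      intro y
      have hι : HasDerivAt (fun a : ℝ => ((a, y) : ℝ × EuclideanSpace ℝ (Fin 3))) ((1 : ℝ), (0 : EuclideanSpace ℝ (Fin 3))) τ :=
        (hasDerivAt_id τ).prodMk (hasDerivAt_const τ y)
      have hc := (hGd y).hasFDerivAt.comp_hasDerivAt τ hι
      have e : (G ∘ fun a : ℝ => ((a, y) : ℝ × EuclideanSpace ℝ (Fin 3))) = fun a => σ * U (-1 + a) y 2 := by funext a; simp [hG]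
      rw [e] at hc
      have eτ : t + 1 = τ := by rw [ht]; ring
      have hc' : HasDerivAt (fun a => σ * U (-1 + a) y 2) (fderiv ℝ G (τ, y) ((1 : ℝ), (0 : EuclideanSpace ℝ (Fin 3)))) (t + 1) := by
        rw [eτ]; exact hc
      have hsh := (HasDerivAt.comp_add_const t 1 hc').const_mul σ
      have e3 : (fun s : ℝ => σ * (σ * U (-1 + (s + 1)) y 2)) = fun s => U s y 2 := by
        funext s; rw [← mul_assoc, hσσ, one_mul, show -1 + (s + 1) = s by ring]
      rw [e3] at hsh
      have hsm : IsSmoothSpaceTimeOn (Iio 0) U := (isTypeIAncientMild_of_class hrate hcont hmild hdiv).contDiffOn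
      have htd : timeDerivWithin (Iio 0) U t y = deriv (fun s => U s y) t := by
        rw [timeDerivWithin_apply, derivWithin_of_mem_nhds (Iio_mem_nhds htneg)]
      have hline : DifferentiableAt ℝ (fun s => U s y) t := by
        have hct : ContDiffAt ℝ ∞ (uncurry U) (t, y) := hsm.contDiffAt isOpen_Iio (mem_Iio.2 htneg) y
        have hd : DifferentiableAt ℝ (uncurry U) (t, y) := hct.differentiableAt (by simp)
        have hl : DifferentiableAt ℝ (fun s : ℝ => ((s, y) : ℝ × EuclideanSpace ℝ (Fin 3))) t :=
          differentiableAt_id.prodMk (differentiableAt_const _)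
        have h := hd.comp t hl
        exact h
      rw [htd, deriv_apply_coord hline 2, hsh.deriv, ← mul_assoc, hσσ, one_mul]
    have hφd : DifferentiableAt ℝ (fun q => fderiv ℝ G q ((1 : ℝ), (0 : EuclideanSpace ℝ (Fin 3)))) (τ, y₀) := by
      set A : (ℝ × EuclideanSpace ℝ (Fin 3) →L[ℝ] ℝ) →L[ℝ] ℝ := ContinuousLinearMap.apply ℝ ℝ ((1 : ℝ), (0 : EuclideanSpace ℝ (Fin 3))) with hA
      have e : (fun q => fderiv ℝ G q ((1 : ℝ), (0 : EuclideanSpace ℝ (Fin 3)))) = A ∘ fderiv ℝ G := by funext q; simp [hA]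
      rw [e]; exact A.differentiableAt.comp _ hDGd
    have hc := hφd.comp y₀ ((differentiableAt_const _).prodMk differentiableAt_id)
    have e : ((fun q => fderiv ℝ G q ((1 : ℝ), (0 : EuclideanSpace ℝ (Fin 3)))) ∘ fun w : EuclideanSpace ℝ (Fin 3) => ((τ, w) : ℝ × EuclideanSpace ℝ (Fin 3))) =
        fun y => σ * (timeDerivWithin (Iio 0) U t y) 2 := by
      funext w; simp only [Function.comp_apply]; exact htime w
    rw [e] at hc
    have := hc.const_mul σ⁻¹
    simp only [← mul_assoc, inv_mul_cancel₀ hσ0, one_mul] at this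
    exact this
  have hDΦ : fderiv ℝ Φ y₀ ν = fderiv ℝ (fun y => (timeDerivWithin (Iio 0) U t y) 2) y₀ ν + fderiv ℝ (fun y => (convect (U t) (U t) y) 2) y₀ ν := by
    rw [hΦ, fderiv_fun_add hAd hCvd]; rfl
  rw [hDΦ, h2law, mul_add]
  linarith [h1law]

end Summit.NavierStokesRegularity.NavierStokesRegularity.Theorems.PoloidalWindowDoorLrcModEntireRidgeWebDynamics

end
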